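import Summits.Langlands.Langlands.Theses.ParityBlindBianchi
import Summits.Langlands.Langlands.Theorems.ParityBlindBianchiResidualBianchiDoorLevelR
import HarnessLib

/-!
# `ResidualBianchiDoorLevelBC` (E1″, crux stmt-Langlands-16853 of route ParityBlindBianchi) BY NAME,
# from Serre's conjecture mod 2 (Khare–Wintenberger) — line `Sketch`, idea `fibre-substitution`

The crux is `QuadraticBaseChangeGL2 → <ResidualBianchiDoorLevelR verbatim>`.  The landed proof of
E1′R (`ResidualBianchiDoorLevelR_of_facts`, p125055) rests on four named facts: `khare_wintenberger`
and the three all-`n` Arthur–Clozel facts `baseChange_cyclic_cuspidal`,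
`ArthurClozel1989_strongLifting_allFinite`, `ArthurClozel1989_strongLifting_archimedean`.  A use-site
census of that line shows the three Arthur–Clozel facts are evaluated only at `(n, F, E) = (2, ℚ, K)`
(inside `Sketch.stub_bcTransfer`, p98028) and the Serre fact only at `p = 2` (inside
`Sketch.stub_qLevel`, p101192).  Replacing each evaluation by the matching FIBRE gives:

* `isRegularAlgebraic_of_archFibre` — regular algebraicity ascends along the `(ℚ, K)`-fibre of
  clause (d) of `QuadraticBaseChangeGL2` (archimedean parameters restrict);
* `stub_bcTransfer_fibre` — the K-side transfer `stub_bcTransfer` with its three all-`n` hypotheses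
  replaced by the `(2, ℚ, K)`-fibres = clauses (a) / (c) / (d) of the hypothesis, written INLINE as
  binder types (no new `def … : Prop`);
* `ResidualBianchiDoorLevelBC_of_qLevelPackage` — the TRANSFER, unconditional: the crux BY NAME from
  the K-free ℚ-level congruence package (inline hypothesis = conclusion of `Sketch.stub_qLevel`,
  ∀-quantified; the interface both idea cards of the crux share);
* `ResidualBianchiDoorLevelBC_of_KW` — the item's filed form: the crux BY NAME from the named fact
  `∀ p k, khare_wintenberger p k` (transfer ∘ `Sketch.stub_qLevel`, which evaluates it at `p = 2`
  only: Serre's modularity conjecture mod `2`, Khare–Wintenberger (I) Thm 1.2 / Thm 9.1 with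
  Kisin's 2-adic Hypothesis (H)).  The sharper engine from `∀ k, khare_wintenberger 2 k` alone
  (`Sketch.stub_qLevel_two`, file `…DoorLevelBCQLevelTwo.lean`) plugs into the same transfer
  (companion file `…DoorLevelBCSerreModTwo.lean`).

Clause (b) of `QuadraticBaseChangeGL2` (unramified strong lifting) is not used.  Trust base of the
closing theorem: the cited named fact `khare_wintenberger`, used at `p = 2` only (`proof.conditional`); the
transfer itself is unconditional; nothing is restated here.
-/

noncomputable section

-- single-conjunct summit: every name here is `Summit.Langlands.Langlands.…` (Sub = Summit), which the
-- dupNamespace linter flags by design of the tree layout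
set_option linter.dupNamespace false

namespace Summit.Langlands.Langlands.Cruxes.ResidualBianchiDoorLevelBC.FibreSubstitution

open scoped MatrixGroups Polynomial Valued Classical
open Polynomial NumberField IsDedekindDomain Filter
open Literature.NumberTheory.Automorphic Literature.NumberTheory.GaloisRepresentations
  Summit.Langlands.Langlands.Theses.ParityBlindBianchi
  Summit.Langlands.Langlands.Cruxes.ResidualBianchiDoorLevel

/-! ## Conventions

The three `(2, ℚ, K)`-FIBRES of the Arthur–Clozel facts are written INLINE as binder types (no new
`def … : Prop`, so a landed copy carries no untagged Prop definitions): fibre (a) = clause (a) of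
`QuadraticBaseChangeGL2` at `F = ℚ, E = K` (cuspidal weak lift given a non-twist witness at an inert
place, A–C III.4.2 (a)); fibre (c) = clause (c) (Satake powers at ALL finite places, A–C III.5.1);
fibre (d) = clause (d) (archimedean parameters restrict, A–C III.5.1 + I §7).
-/

/-! ## Regular algebraicity ascends along the archimedean fibre -/

/-- `n = 2`, `(ℚ, K)` copy of `ArthurClozel1989_strongLifting_archimedean.isRegularAlgebraic_baseChange`
reading the archimedean transfer off the `(ℚ, K)`-fibre of clause (d) instead of the all-`n` named fact:
`T ↦ T^K` keeps the exponents. [cite: ArthurClozelAMS120, Ch. 3 Thm. 5.1 and Ch. 1 §7]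
[cite: Clozel1990, Déf. 3.12] -/
theorem isRegularAlgebraic_of_archFibre {K : Type} [Field K] [NumberField K]
    {hF : isCompact_glFiniteIntegralLevel 2 ℚ} {hE : isCompact_glFiniteIntegralLevel 2 K}
    {π : CuspidalAutomorphicRepData 2 ℚ hF} {P : CuspidalAutomorphicRepData 2 K hE}
    (hD : IsWeakBaseChangeLiftAE π.1 P.1 →
      ∀ χ : (ℚ →+* ℂ) → Multiset ℂ, π.1.HasArchParameter χ →
        P.1.HasArchParameter fun τ => χ (τ.comp (algebraMap ℚ K)))
    (hBC : IsWeakBaseChangeLiftAE π.1 P.1) (hπ : π.1.IsRegularAlgebraic) :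
    P.1.IsRegularAlgebraic := by
  obtain ⟨T, hT, hC, hR⟩ := hπ
  refine ⟨T.baseChange K, ⟨hT.1.baseChange, ?_⟩, hC.baseChange, hR.baseChange⟩
  have := hD hBC (fun σ => (T σ).map ArchWeight.a) hT.2
  simpa [InfinityType.baseChange] using this

/-! ## First lemma of the line: the K-side transfer over the fibres -/

/-- **`stub_bcTransfer_fibre`** — the landed `Sketch.stub_bcTransfer` (p98028) with its three
all-`n` named-fact hypotheses replaced by the `(2, ℚ, K)`-fibres: for `σ₀, S, π` as in
`stub_qLevel`, a quadratic `K` and a non-twist witness at an inert place, `Π = BC_K(π)` is regular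
algebraic cuspidal and congruent to `σ₀|_{Γ_K}` at EVERY place of `K` over no prime of `S`.
Proof = the landed proof with the three use-sites swapped. [cite: ArthurClozelAMS120, Ch. 3 Thm. 4.2 (a) and Thm. 5.1] -/
theorem stub_bcTransfer_fibre (K : Type) [Field K] [NumberField K] (hK : Module.finrank ℚ K = 2)
    (hA : ∀ (hF : isCompact_glFiniteIntegralLevel 2 ℚ) (π : CuspidalAutomorphicRepData 2 ℚ hF),
      (∃ (v : HeightOneSpectrum (𝓞 ℚ)) (w : HeightOneSpectrum (𝓞 K)) (α : Multiset ℂ),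
          w.asIdeal.under (𝓞 ℚ) = v.asIdeal ∧ w.asIdeal.inertiaDeg (𝓞 ℚ) = Module.finrank ℚ K ∧
          π.1.HasSatakeParamAt v α ∧
          ∀ ζ : ℂ, IsPrimitiveRoot ζ (Module.finrank ℚ K) → α.map (ζ * ·) ≠ α) →
      ∀ (hE : isCompact_glFiniteIntegralLevel 2 K),
        ∃ P : CuspidalAutomorphicRepData 2 K hE, IsWeakBaseChangeLiftAE π.1 P.1)
    (hCfin : ∀ (hF : isCompact_glFiniteIntegralLevel 2 ℚ) (hE : isCompact_glFiniteIntegralLevel 2 K)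
      (π : CuspidalAutomorphicRepData 2 ℚ hF) (P : CuspidalAutomorphicRepData 2 K hE),
      IsWeakBaseChangeLiftAE π.1 P.1 →
        ∀ (w : HeightOneSpectrum (𝓞 K)) (v : HeightOneSpectrum (𝓞 ℚ)) (α : Multiset ℂ),
          w.asIdeal.under (𝓞 ℚ) = v.asIdeal → π.1.HasSatakeParamAt v α →
            P.1.HasSatakeParamAt w (α.map (· ^ w.asIdeal.inertiaDeg (𝓞 ℚ))))
    (hD : ∀ (hF : isCompact_glFiniteIntegralLevel 2 ℚ) (hE : isCompact_glFiniteIntegralLevel 2 K)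
      (π : CuspidalAutomorphicRepData 2 ℚ hF) (P : CuspidalAutomorphicRepData 2 K hE),
      IsWeakBaseChangeLiftAE π.1 P.1 →
        ∀ χ : (ℚ →+* ℂ) → Multiset ℂ, π.1.HasArchParameter χ →
          P.1.HasArchParameter fun τ => χ (τ.comp (algebraMap ℚ K)))
    (ι : PadicAlgCl 2 ≃+* ℂ) (σ₀ : FramedGaloisRep ℚ (PadicAlgCl 2) 2)
    (S : Finset ℕ) (hcptQ : isCompact_glFiniteIntegralLevel 2 ℚ)
    (πQ : CuspidalAutomorphicRepData 2 ℚ hcptQ) (hRA : πQ.1.IsRegularAlgebraic)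
    (hgood : ∀ v : HeightOneSpectrum (𝓞 ℚ), (∀ ℓ ∈ S, ((ℓ : ℕ) : 𝓞 ℚ) ∉ v.asIdeal) →
      ∃ (α : Multiset ℂ) (a b : PadicAlgCl 2), ‖a‖ ≤ 1 ∧ ‖b‖ ≤ 1 ∧
        πQ.1.HasSatakeParamAt v α ∧ σ₀.IsUnramifiedAt v ∧
        σ₀.HasFrobCharpolyAt v ((X - C a) * (X - C b)) ∧
        ∀ i : ℕ, ‖((X - C a) * (X - C b)).coeff i -
          (arithFrobPolyOfSatake ι v.residueCard 2 α).coeff i‖ < 1)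
    (hne : ∃ (v : HeightOneSpectrum (𝓞 ℚ)) (w : HeightOneSpectrum (𝓞 K)) (α : Multiset ℂ),
      w.asIdeal.under (𝓞 ℚ) = v.asIdeal ∧ w.asIdeal.inertiaDeg (𝓞 ℚ) = Module.finrank ℚ K ∧
      πQ.1.HasSatakeParamAt v α ∧
      ∀ ζ : ℂ, IsPrimitiveRoot ζ (Module.finrank ℚ K) → α.map (ζ * ·) ≠ α) :
    ∃ (hcpt : isCompact_glFiniteIntegralLevel 2 K) (π₀ : CuspidalAutomorphicRepData 2 K hcpt),
      π₀.1.IsRegularAlgebraic ∧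
        ∀ w : HeightOneSpectrum (𝓞 K), (∀ ℓ ∈ S, ((ℓ : ℕ) : 𝓞 K) ∉ w.asIdeal) →
          ∃ (α : Multiset ℂ) (P : Polynomial (PadicAlgCl 2)), π₀.1.HasSatakeParamAt w α ∧
            (σ₀.restrictField K).IsUnramifiedAt w ∧ (σ₀.restrictField K).HasFrobCharpolyAt w P ∧
            ∀ i : ℕ, ‖P.coeff i - (arithFrobPolyOfSatake ι w.residueCard 2 α).coeff i‖ < 1 := by
  -- (2) the cuspidal weak lift `Π = BC_K(π)` (fibre (a)), regular algebraic (fibre (d))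
  have hcpt : isCompact_glFiniteIntegralLevel 2 K := isCompact_glFiniteIntegralLevel_holds 2 K
  obtain ⟨P, hlift⟩ := hA hcptQ πQ hne hcpt
  have hRAP : P.1.IsRegularAlgebraic := isRegularAlgebraic_of_archFibre (hD hcptQ hcpt πQ P) hlift hRA
  refine ⟨hcpt, P, hRAP, fun w hw' => ?_⟩
  -- (3) the place `v` of `ℚ` below `w` is good
  set v : HeightOneSpectrum (𝓞 ℚ) := w.under (𝓞 ℚ) with hvdef
  have hw : w.asIdeal.under (𝓞 ℚ) = v.asIdeal := rfl
  have hv : ∀ ℓ ∈ S, ((ℓ : ℕ) : 𝓞 ℚ) ∉ v.asIdeal := by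
    intro ℓ hℓ hmem
    apply hw' ℓ hℓ
    rw [← hw, Ideal.under_def, Ideal.mem_comap, map_natCast] at hmem
    exact hmem
  obtain ⟨α, a, b, ha, hb, hsat, hunr, hFrob, hcongr⟩ := hgood v hv
  -- (4) Satake at `w` (fibre (c)), (5) the Galois side at `w`
  have hsatw := hCfin hcptQ hcpt πQ P hlift w v α hw hsat
  have hunrw : (σ₀.restrictField K).IsUnramifiedAt w := σ₀.isUnramifiedAt_restrictField hw hunr
  have hFrobw := σ₀.hasFrobCharpolyAt_restrictField_fin_two (E := K) hw hunr hFrob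
  refine ⟨_, _, hsatw, hunrw, hFrobw, ?_⟩
  -- (6) the congruence at `w`, `q_w = q_v ^ f`, `f ∈ {1, 2}`
  rw [residueCard_eq_pow_inertiaDeg_of_under_eq hw]
  rcases inertiaDeg_eq_one_or_two_of_finrank_eq_two hK v w hw with hf | hf
  · rw [hf]
    simpa only [pow_one, Multiset.map_id'] using hcongr
  · rw [hf]
    exact Sketch.arithFrobPolyOfSatake_congr_sq ι hsat.card_eq ha hb hcongr

end Summit.Langlands.Langlands.Cruxes.ResidualBianchiDoorLevelBC.FibreSubstitution

namespace Summit.Langlands.Langlands.Theorems.ParityBlindBianchi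

open scoped MatrixGroups Polynomial
open Polynomial NumberField IsDedekindDomain
open Literature.NumberTheory.Automorphic Literature.NumberTheory.GaloisRepresentations
  Summit.Langlands.Langlands.Cruxes.ResidualBianchiDoorLevel
  Summit.Langlands.Langlands.Cruxes.ResidualBianchiDoorLevelBC.FibreSubstitution

/-- **The transfer C⁺ → E1″** (crux `ResidualBianchiDoorLevelBC` BY NAME from the K-free ℚ-level
congruence package).  Hypothesis (INLINE, verbatim the conclusion of the landed `Sketch.stub_qLevel`
universally quantified — the interface `QLevelPackage` of the crux's second idea card
golden-surface-two-torsion, whose stub P1 is therefore `fun h => this h`): for every `ι : ℚ̄₂ ≃+* ℂ`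
and irreducible icosahedral `ρ`, a finite set of PRIMES `S ∋ 2`, the entrywise model
`σ₀ = GL₂(ι⁻¹) ∘ ρ` and a regular algebraic cuspidal `π` on `GL₂(𝔸_ℚ)` congruent to `σ₀`
(coefficientwise in `𝔪_{ℤ̄₂}`, HLTT `m = 2`) at every place off `S`.  Conclusion: the crux, i.e.
granted quadratic base change for `GL₂` (its antecedent `QuadraticBaseChangeGL2`), the uniform bad
set `S₀ := S` (`0 ∉ S` as `0` is not prime) and, for every imaginary quadratic `K` with `2` split,
`σ = σ₀|_{Γ_K}` (`ResidualBianchiDoorMod2.exists_padicModel_restrictField`: entrywise `ι`-model of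
`ρ|_K`, finite image, irreducible, projectively `A₅`) with `π₀ = BC_K(π)` from
`Sketch.stub_cuspWitness` + `stub_bcTransfer_fibre` fed by clauses (a), (c), (d) of the antecedent
at `(F, E) := (ℚ, K)` (finrank `2` ⇒ Galois).  UNCONDITIONAL (no named fact is used): this is the
body of p125055 `ResidualBianchiDoorLevelR_of_facts` with the engine abstracted and the three
Arthur–Clozel facts read off the hypothesis of the crux.
[cite: ArthurClozelAMS120, Ch. 3 Thm. 4.2 (a) and Thm. 5.1] -/
theorem ResidualBianchiDoorLevelBC_of_qLevelPackage
    (hC : ∀ (ι : PadicAlgCl 2 ≃+* ℂ) (ρ : FramedGaloisRep ℚ ℂ 2), ρ.toGaloisRep.IsIrreducible →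
      Nonempty ((Matrix.ProjGenLinGroup.mk.comp ρ.toMonoidHom).range ≃* alternatingGroup (Fin 5)) →
      ∃ S : Finset ℕ, 2 ∈ S ∧ (∀ ℓ ∈ S, ℓ.Prime) ∧ ∃ σ₀ : FramedGaloisRep ℚ (PadicAlgCl 2) 2,
        σ₀.toMonoidHom = (Matrix.GeneralLinearGroup.map ι.symm.toRingHom).comp ρ.toMonoidHom ∧
        ∃ (hcpt : isCompact_glFiniteIntegralLevel 2 ℚ) (π : CuspidalAutomorphicRepData 2 ℚ hcpt),
          π.1.IsRegularAlgebraic ∧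
          ∀ v : HeightOneSpectrum (𝓞 ℚ), (∀ ℓ ∈ S, ((ℓ : ℕ) : 𝓞 ℚ) ∉ v.asIdeal) →
            ∃ (α : Multiset ℂ) (a b : PadicAlgCl 2), ‖a‖ ≤ 1 ∧ ‖b‖ ≤ 1 ∧
              π.1.HasSatakeParamAt v α ∧ σ₀.IsUnramifiedAt v ∧
              σ₀.HasFrobCharpolyAt v ((X - C a) * (X - C b)) ∧
              ∀ i : ℕ, ‖((X - C a) * (X - C b)).coeff i -
                (arithFrobPolyOfSatake ι v.residueCard 2 α).coeff i‖ < 1) :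
    Summit.Langlands.Langlands.Theses.ParityBlindBianchi.ResidualBianchiDoorLevelBC := by
  intro hQ ι ρ hirr hA5
  obtain ⟨S, h2S, hS, σ₀, hσ₀, hcptQ, πQ, hRA, hgood⟩ := hC ι ρ hirr hA5
  refine ⟨S, h2S, fun h0 => Nat.not_prime_zero (hS 0 h0), ?_⟩
  intro K _ _ _htc hdeg _hsplit
  -- the Galois side: the same `σ₀`, restricted to `Γ_K`
  obtain ⟨σ₀', hσ₀', hfin, hproj, hmodel, hfinK, hirrK, hA5K⟩ :=
    Summit.Langlands.Langlands.Theorems.ResidualBianchiDoorMod2.exists_padicModel_restrictField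
      ι ρ hA5 K hdeg
  obtain rfl : σ₀' = σ₀ := Sketch.framedGaloisRep_eq_of_toMonoidHom_eq (hσ₀'.trans hσ₀.symm)
  -- the automorphic side over `K`: the three fibres of the hypothesis at `(ℚ, K)` = clauses
  -- (a) `hQ.1`, (c) `hQ.2.2.1`, (d) `hQ.2.2.2` instantiated at `F := ℚ`, `E := K` (quadratic ⇒ Galois)
  haveI : Algebra.IsQuadraticExtension ℚ K := ⟨hdeg⟩
  haveI : IsGalois ℚ K := inferInstance
  obtain ⟨hcpt, π₀, hRA₀, hgood₀⟩ := stub_bcTransfer_fibre K hdeg (hQ.1 ℚ K hdeg)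
    (hQ.2.2.1 ℚ K hdeg) (hQ.2.2.2 ℚ K hdeg) ι σ₀' S hcptQ πQ hRA hgood
    (Sketch.stub_cuspWitness ι σ₀' hfin hproj S hS hcptQ πQ hgood K hdeg)
  exact ⟨σ₀'.restrictField K, hmodel, hfinK, hirrK, hA5K, hcpt, π₀, hRA₀, hgood₀⟩

/-- **E1″ from Khare–Wintenberger** (crux `ResidualBianchiDoorLevelBC` BY NAME, in the form the
item files it: hypothesis the named fact `khare_wintenberger p k` for all `p`, `k`, evaluated at
`p = 2` only).  For `ι : ℚ̄₂ ≃+* ℂ` and an irreducible icosahedral Artin `ρ : Γ_ℚ → GL₂(ℂ)`, granted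
quadratic base change for `GL₂` (the antecedent): a finite set `S₀ ∋ 2`, `0 ∉ S₀`, of naturals
(indeed of primes) such that for every imaginary quadratic `K` with `2` split, `σ := ι⁻¹ ∘ ρ|_{Γ_K}`
entrywise is a framed `ℚ̄₂`-representation of finite image, irreducible, projectively `A₅`, and a
regular algebraic cuspidal `π₀` on `GL₂(𝔸_K)` is congruent to it (coefficientwise in `𝔪_{ℤ̄₂}`,
HLTT `m = 2`) at every place of `K` over no prime of `S₀`.  Proof: the transfer
`ResidualBianchiDoorLevelBC_of_qLevelPackage` fed with the engine `Sketch.stub_qLevel` (p101192: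
Serre mod `2`, odd for free; the ℚ-level newform, its conjugate, the adelic lift, the `m = 2`
congruence); equivalently p125055 `ResidualBianchiDoorLevelR_of_facts` with
`Sketch.stub_bcTransfer ↦ stub_bcTransfer_fibre`.  CONDITIONAL on `khare_wintenberger` (at `p = 2`:
Khare–Wintenberger (I) Thm 1.2 for `k(ρ̄) = 2`, Thm 9.1 under Kisin's 2-adic Hypothesis (H) for
`k(ρ̄) = 4`), an in-tree named fact not restated here.
[cite: KhareWintenberger2009, Thm. 1.2 and Thm. 9.1] [cite: Kisin2009TwoAdic, Thm. 0.1, Cor. 0.2] -/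
theorem ResidualBianchiDoorLevelBC_of_KW
    (hKW : ∀ (p : ℕ) [Fact p.Prime] (k : Type) [Field k] [TopologicalSpace k] [DiscreteTopology k],
      khare_wintenberger p k) :
    Summit.Langlands.Langlands.Theses.ParityBlindBianchi.ResidualBianchiDoorLevelBC :=
  ResidualBianchiDoorLevelBC_of_qLevelPackage fun ι ρ hirr hA5 => Sketch.stub_qLevel hKW ι ρ hirr hA5

end Summit.Langlands.Langlands.Theorems.ParityBlindBianchi

end
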